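import Summits.KontsevichZagierPeriods.KontsevichZagierPeriods.Theses.HurwitzMicroSectors
import Summits.KontsevichZagierPeriods.KontsevichZagierPeriods.Theorems.HurwitzMicroSectorsNormalFormPrinciplePiBoxTransfer
import Summits.KontsevichZagierPeriods.KontsevichZagierPeriods.Theorems.HurwitzMicroSectorsNormalFormPrincipleVariants2239

/-! TTRL-lite variant V2339 of stmt-KontsevichZagierPeriods-3869

Variant V2339 = `stub_boxRigidity` (BoxRigidity: two box-rational representations with equal values
are KZ-equivalent) under the move `fix_nat:m'=2; bound_nat:m≤3`: the right dimension frozen to `2`,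
the left one bounded by `3`. Verdict of the attempt seat: **open** — this file is the certificate, not
a proof of the variant. The variant is EQUIVALENT to box-vanishing in dimension `3`
(`stub_boxRigidity_var2339_iff_boxVanishing_three`): every box-rational representation on `(0,1)³`
of value `0` is a KZ relation; and equivalently to the two-sided bounded parent `m, m' ≤ 3`
(`stub_boxRigidity_var2339_iff_boxRigidity_le_three`). More generally, for every `m₀ ≤ K` the move
`fix_nat:m'=m₀; bound_nat:m≤K` of this stub produces exactly BoxVanishing(`K`)
(`boxRigidityBoundFix_iff_boxVanishing`), by padding with unit intervals and subtracting on a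
common box (`boxRigidityLe_of_boxVanishing`, `boxVanishing_mono` of the sibling certificate
`…Variants2239`, from `stub_boxCombineAux.pad_le` / `sub_same`) one way and the zero representation on
`(0,1)^{m₀}` the other; in particular V2339 ⟺ V2239 (`stub_boxRigidity_var2339_iff_var2239`).
BoxVanishing(`3`) contains, for instance, every implication "`ζ(3) = r·π³` (`r ∈ ℚ`) ⇒ the two
box-rational representations `∫_{(0,1)³} dx dy dz/(1−xyz)` and `r·∫_{(0,1)³} 4³/((1+x²)(1+y²)(1+z²))`
are KZ-equivalent" and "Catalan's `G = r` ⇒ `[(0,1)², 1/(1+x²y²)] ∼ [r]`": a proof must decide such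
(open) irrationality questions or derive the equivalences, a refutation must separate KZ-classes of
equal value (no invariant beyond `eval` is known); compare the sub-family `P(xy)/(1−(xy)⁶)` on
`(0,1)²` (item `SectorTwoSix`), closed only modulo the 2024 independence of `1, π², L(2,χ₋₃)`.
Upward: `KontsevichZagierPeriods ⇒ parent ⇒ V2339` (`stub_boxRigidity_var2339_of_statement`).
Contrast: the two-sided instance `m, m' ≤ 1` is a theorem (Baker).
Source: M. Kontsevich, D. Zagier, *Periods* (2001), §1.2 Conjecture 1. Pure proof file, no definitions. -/

-- `Summit.<Summit>.<Problem>` is the tree's mandated summit-side namespace (CONVENTIONS §2); for this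
-- single-conjunct summit the two coincide, so the duplicate is deliberate.
set_option linter.dupNamespace false

noncomputable section

namespace Summit.KontsevichZagierPeriods.KontsevichZagierPeriods.Theorems

open MeasureTheory Set
open Literature.NumberTheory.Transcendental Literature.NumberTheory.Transcendental.KZ
open Summit.KontsevichZagierPeriods.KontsevichZagierPeriods.Theses.HurwitzMicroSectors
open Summit.KontsevichZagierPeriods.HurwitzMicroSectors.NormalFormPrinciple.PiBox

/-! ## One dimension frozen, the other bounded -/

/-- **One dimension frozen to `m₀ ≤ K`, the other bounded by `K` ⟺ BoxVanishing(`K`).** Forward: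
compare a box-rational representation of value `0` and dimension `K` with the zero representation
on `(0,1)^{m₀}`; backward: `boxRigidityLe_of_boxVanishing` (pad to `(0,1)ᴷ`, subtract, soundness). So every programmatic move
`fix_nat:m'=m₀; bound_nat:m≤K` (`m₀ ≤ K`) of `stub_boxRigidity` yields exactly BoxVanishing(`K`).
[cite: KontsevichZagier2001, §1.2 Conjecture 1] -/
theorem boxRigidityBoundFix_iff_boxVanishing {K m₀ : ℕ} (h₀ : m₀ ≤ K) :
    (∀ (m : ℕ) (N : IntegralRep m) (N' : IntegralRep m₀), m ≤ K →
      N.domain = {x | ∀ i, x i ∈ Set.Ioo (0:ℝ) 1} → N.IsRational →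
      N'.domain = {x | ∀ i, x i ∈ Set.Ioo (0:ℝ) 1} → N'.IsRational →
      N.value = N'.value → Equivalent N N') ↔
    (∀ (N : IntegralRep K), N.domain = {x | ∀ i, x i ∈ Set.Ioo (0:ℝ) 1} → N.IsRational →
      N.value = 0 → of N ∈ relations) := by
  refine ⟨fun hrig N hNd hNr hv => ?_, fun hvan m N N' hm =>
    boxRigidityLe_of_boxVanishing (j := K) (k := K) le_rfl le_rfl hvan m m₀ N N' h₀ hm⟩
  obtain ⟨Z, hZd, hZi⟩ := exists_zeroRep (isSemialgebraic_box m₀)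
  have hZ : of Z ∈ relations := of_mem_relations_of_eqOn_zero Z (by simp [hZi, EqOn])
  have hZv : Z.value = 0 := by simp [IntegralRep.value, hZi]
  have hZr : Z.IsRational := ⟨0, 1, fun x _ => by simp, fun x _ => by simp [hZi]⟩
  have h : of N - of Z ∈ relations := hrig K N Z le_rfl hNd hNr hZd hZr (by rw [hv, hZv])
  have := relations.add_mem h hZ
  rwa [sub_add_cancel] at this

/-! ## The variant V2339 itself -/

/-- **V2339 ⟺ BoxVanishing(`3`)**: every box-rational representation on `(0,1)³` of value `0` is a
KZ relation (instance `K = 3`, `m₀ = 2` of `boxRigidityBoundFix_iff_boxVanishing`).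
[cite: KontsevichZagier2001, §1.2 Conjecture 1] -/
theorem stub_boxRigidity_var2339_iff_boxVanishing_three :
    (∀ (m : ℕ) (N : IntegralRep m) (N' : IntegralRep 2), m ≤ 3 → N.domain = {x | ∀ i, x i ∈ Set.Ioo (0:ℝ) 1} → N.IsRational → N'.domain = {x | ∀ i, x i ∈ Set.Ioo (0:ℝ) 1} → N'.IsRational → N.value = N'.value → Equivalent N N') ↔
    (∀ (N : IntegralRep 3), N.domain = {x | ∀ i, x i ∈ Set.Ioo (0:ℝ) 1} → N.IsRational →
      N.value = 0 → of N ∈ relations) :=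
  boxRigidityBoundFix_iff_boxVanishing (by norm_num)

/-- **V2339 ⟺ V2239** (the sibling variant `bound_nat:m≤3; bound_nat:m'≤2`): both are
BoxVanishing(`3`). [cite: KontsevichZagier2001, §1.2 Conjecture 1] -/
theorem stub_boxRigidity_var2339_iff_var2239 :
    (∀ (m : ℕ) (N : IntegralRep m) (N' : IntegralRep 2), m ≤ 3 → N.domain = {x | ∀ i, x i ∈ Set.Ioo (0:ℝ) 1} → N.IsRational → N'.domain = {x | ∀ i, x i ∈ Set.Ioo (0:ℝ) 1} → N'.IsRational → N.value = N'.value → Equivalent N N') ↔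
    (∀ (m m' : ℕ) (N : IntegralRep m) (N' : IntegralRep m'), m' ≤ 2 → m ≤ 3 → N.domain = {x | ∀ i, x i ∈ Set.Ioo (0:ℝ) 1} → N.IsRational → N'.domain = {x | ∀ i, x i ∈ Set.Ioo (0:ℝ) 1} → N'.IsRational → N.value = N'.value → Equivalent N N') :=
  stub_boxRigidity_var2339_iff_boxVanishing_three.trans
    stub_boxRigidity_var2239_iff_boxVanishing_three.symm

/-- **V2339 ⟺ the two-sided bounded parent `m, m' ≤ 3`** (so freezing `m' := 2` inside the bound
loses nothing). [cite: KontsevichZagier2001, §1.2 Conjecture 1] -/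
theorem stub_boxRigidity_var2339_iff_boxRigidity_le_three :
    (∀ (m : ℕ) (N : IntegralRep m) (N' : IntegralRep 2), m ≤ 3 → N.domain = {x | ∀ i, x i ∈ Set.Ioo (0:ℝ) 1} → N.IsRational → N'.domain = {x | ∀ i, x i ∈ Set.Ioo (0:ℝ) 1} → N'.IsRational → N.value = N'.value → Equivalent N N') ↔
    (∀ (m m' : ℕ) (N : IntegralRep m) (N' : IntegralRep m'), m' ≤ 3 → m ≤ 3 →
      N.domain = {x | ∀ i, x i ∈ Set.Ioo (0:ℝ) 1} → N.IsRational →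
      N'.domain = {x | ∀ i, x i ∈ Set.Ioo (0:ℝ) 1} → N'.IsRational →
      N.value = N'.value → Equivalent N N') :=
  stub_boxRigidity_var2339_iff_var2239.trans stub_boxRigidity_var2239_iff_le_three

/-- **V2339 ⇒ BoxVanishing in every dimension `≤ 3`** (monotonicity). [cite: KontsevichZagier2001, §1.2 Conjecture 1] -/
theorem boxVanishing_le_three_of_stub_boxRigidity_var2339
    (h : ∀ (m : ℕ) (N : IntegralRep m) (N' : IntegralRep 2), m ≤ 3 → N.domain = {x | ∀ i, x i ∈ Set.Ioo (0:ℝ) 1} → N.IsRational → N'.domain = {x | ∀ i, x i ∈ Set.Ioo (0:ℝ) 1} → N'.IsRational → N.value = N'.value → Equivalent N N')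
    {m : ℕ} (hm : m ≤ 3) (N : IntegralRep m) (hNd : N.domain = {x | ∀ i, x i ∈ Set.Ioo (0:ℝ) 1})
    (hNr : N.IsRational) (hv : N.value = 0) : of N ∈ relations :=
  boxVanishing_mono hm (stub_boxRigidity_var2339_iff_boxVanishing_three.1 h) N hNd hNr hv

/-- **parent ⇒ V2339** (the variant is a specialisation of `stub_boxRigidity`).
[cite: KontsevichZagier2001, §1.2 Conjecture 1] -/
theorem stub_boxRigidity_var2339_of_parent
    (h : ∀ (m m' : ℕ) (N : IntegralRep m) (N' : IntegralRep m'), N.domain = {x | ∀ i, x i ∈ Set.Ioo (0:ℝ) 1} → N.IsRational → N'.domain = {x | ∀ i, x i ∈ Set.Ioo (0:ℝ) 1} → N'.IsRational → N.value = N'.value → Equivalent N N') :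
    ∀ (m : ℕ) (N : IntegralRep m) (N' : IntegralRep 2), m ≤ 3 → N.domain = {x | ∀ i, x i ∈ Set.Ioo (0:ℝ) 1} → N.IsRational → N'.domain = {x | ∀ i, x i ∈ Set.Ioo (0:ℝ) 1} → N'.IsRational → N.value = N'.value → Equivalent N N' :=
  fun m N N' _ => h m 2 N N'

/-- **`KontsevichZagierPeriods ⇒ V2339`**: the variant is a special case of Conjecture 1 for the
tree's calculus — a refutation of the variant would refute the Summit.
[cite: KontsevichZagier2001, §1.2 Conjecture 1] -/
theorem stub_boxRigidity_var2339_of_statement (h : _root_.KontsevichZagierPeriods) :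
    ∀ (m : ℕ) (N : IntegralRep m) (N' : IntegralRep 2), m ≤ 3 → N.domain = {x | ∀ i, x i ∈ Set.Ioo (0:ℝ) 1} → N.IsRational → N'.domain = {x | ∀ i, x i ∈ Set.Ioo (0:ℝ) 1} → N'.IsRational → N.value = N'.value → Equivalent N N' :=
  stub_boxRigidity_var2339_of_parent (leaves_of_statement h).1

end Summit.KontsevichZagierPeriods.KontsevichZagierPeriods.Theorems
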